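import Summits.Ventures.Crystal3D.Theorems.StickyWulffConstantCoaxialWallLawChainTorsionLedger
import HarnessLib

/-!
# TWIN pairs at level ⅓: only the COHERENT Σ3 twin is registered — every displaced twin is free at `½κ₁`
# (crux `CoaxialWallLaw`, stmt-Ventures-19481, line `WallLedgerF`)

HONEST FRAMING. Venture `Summits/Ventures/Crystal3D` (cell `crystal3d-full`), helper `--supports` the crux `CoaxialWallLaw`
of `route-Ventures-StickyWulffConstant` (REGISTERED line `WallLedgerF`, open stub `stub_coaxialTwoSlabAdhesion`).  Rung credit
only; F-C1 not moved; NOT the stub: the COHERENT Σ3 twin (`t₂ − t₁ ∈ DSC`, 3 of the 27 level-⅓ classes) — i.e. the inclined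
coherent-twin wall / CSL {112} riser — remains the census, and `ExactOnly`(C12-55) [E1] / `StarPairFar` stay BY NAME.

The twin analogue of `…ChainTorsionLedger`.  A TWIN pair `A₂·Λ₀ = R_{n₁}(A₁·Λ₀)` about a `{111}` plane `n₁` of grain 1 that
contains the STEEP slot `u₁` positively (`⟪A₁u₁, n₁⟫ = √(2/3)` — the vicinal regime: twin plane ≈ wall plane): a far-lattice
ball is `A₁x − 2a√(2/3)n₁` (`inner_lattice_menu`), so the one-sided registry is again `A₁·Λ₀ + reachGroup`, whose level-⅓
part is `A₁·Λ₀ + ℤ√(2/3)n₁ + ℤ√(2/3)n₂` (`reachGroup_chainFrames_torsion`) ⊇ the DSC lattice `A₁·Λ₀ + ℤ√(2/3)n₁`.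
* `oneSided_offReach_of_level_third_twin` — offset of level ⅓ outside those 9 classes ⇒ grain 1's reach set misses the far
  affine lattice;
* **`twoSlabLedgerAt_oneSided_of_level_third_twin`**, **`coaxialTwoSlabAdhesion_of_level_third_twin`** (+ `_coords` with the
  zone-axis slot `u*`: `3 ∤ 2⟪y, u*⟫`) — `TwoSlabLedgerAt (½κ₁)` resp. the stub's conclusion VERBATIM, ARBITRARY fillings,
  modulo E1/StarPairFar.
READING.  Intersecting over the steep slots of the twin plane (≥ 2 of them whenever the twin plane is within the steep cone
of the wall): of the 9 classes of `⅓Λ/DSC` only the COHERENT twin (class `0`) is registered; the 6 DISPLACED twins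
(twin + a partial of another plane) are FREE for arbitrary fillings.  Numerics (calc/reach8.py, two-sided) agree: 3/9 per
slot, 1/9 jointly.
WHAT THIS IS NOT: not the stub; F-C1 not moved.
-/

noncomputable section

namespace Summit.Ventures.Crystal3D.Theorems

open Summit.Ventures.Crystal3D Finset
open Literature.MathematicalPhysics.StatisticalMechanics (fccStacking barlowStacking IsHaggSeq contactDeficiency)
open scoped InnerProductSpace

/-- **Grain 1's reach set misses the far affine lattice of a TWIN partner** `A₂·Λ₀ = R_{n₁}(A₁·Λ₀)` (twin plane `n₁ ∋ u₁`)
whose offset is of level ⅓ and outside `A₁·Λ₀ + ℤ√(2/3)n₁ + ℤ√(2/3)n₂`. -/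
theorem oneSided_offReach_of_level_third_twin (z : EuclideanSpace ℝ (Fin 3))
    (A₁ : EuclideanSpace ℝ (Fin 3) ≃ₗᵢ[ℝ] EuclideanSpace ℝ (Fin 3)) (t₁ : EuclideanSpace ℝ (Fin 3))
    (A₂ : EuclideanSpace ℝ (Fin 3) ≃ₗᵢ[ℝ] EuclideanSpace ℝ (Fin 3)) (t₂ : EuclideanSpace ℝ (Fin 3))
    {u₁ n₁ : EuclideanSpace ℝ (Fin 3)} (hu₁ : u₁ ∈ fccSlots) (hn₁ : ‖n₁‖ = 1)
    (hmenu₁ : ∀ w ∈ fccSlots, ⟪A₁ w, n₁⟫_ℝ = 0 ∨ ⟪A₁ w, n₁⟫_ℝ = Real.sqrt (2 / 3) ∨ ⟪A₁ w, n₁⟫_ℝ = -Real.sqrt (2 / 3))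
    (hun : ⟪A₁ u₁, n₁⟫_ℝ = Real.sqrt (2 / 3))
    (hΛ : A₂ '' fccStacking 1 (Real.sqrt (2 / 3)) = twinFrame A₁ n₁ '' fccStacking 1 (Real.sqrt (2 / 3)))
    (h3 : A₁.symm ((3 : ℝ) • (t₂ - t₁)) ∈ fccStacking 1 (Real.sqrt (2 / 3)))
    (hnot : ∀ a b : ℤ, A₁.symm (t₂ - t₁ - (a : ℝ) • (Real.sqrt (2 / 3) • n₁) -
      (b : ℝ) • (Real.sqrt (2 / 3) • ((2 * Real.sqrt (2 / 3)) • A₁ u₁ - n₁))) ∉ fccStacking 1 (Real.sqrt (2 / 3))) :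
    ∀ y ∈ reachSet A₁ t₁ (chainFrames z A₁ u₁), y ∉ (fun q => A₂ q + t₂) '' fccStacking 1 (Real.sqrt (2 / 3)) := by
  rintro y ⟨x₁, hx₁, v, hv, rfl⟩ ⟨x₂, hx₂, hy⟩
  have hA₂x₂ : A₂ x₂ ∈ twinFrame A₁ n₁ '' fccStacking 1 (Real.sqrt (2 / 3)) := hΛ ▸ ⟨x₂, hx₂, rfl⟩
  obtain ⟨x₂', hx₂', hx₂'eq⟩ := hA₂x₂
  obtain ⟨c, hc⟩ := inner_lattice_menu A₁ hmenu₁ hx₂'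
  -- `A₂ x₂ = A₁ x₂' − 2c·√(2/3) n₁`
  have hfar : A₂ x₂ = A₁ x₂' - ((2 * c : ℤ) : ℝ) • (Real.sqrt (2 / 3) • n₁) := by
    rw [← hx₂'eq, twinFrame_apply A₁ hn₁, hc]; push_cast; module
  -- `3·√(2/3) n₁ ∈ M`
  have h3n : A₁.symm ((3 : ℝ) • (Real.sqrt (2 / 3) • n₁)) ∈ fccStacking 1 (Real.sqrt (2 / 3)) := by
    obtain ⟨w, hw, hAw⟩ := exists_lattice_eq_sqrt6_menu A₁ hmenu₁
    have e : (3 : ℝ) • (Real.sqrt (2 / 3) • n₁) = A₁ w := by rw [hAw, smul_smul, three_mul_sqrt_twoThirds]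
    rw [e, LinearIsometryEquiv.symm_apply_apply]; exact hw
  have hv_eq : v = (t₂ - t₁) + (A₁ x₂' - A₁ x₁) - ((2 * c : ℤ) : ℝ) • (Real.sqrt (2 / 3) • n₁) := by
    have : A₂ x₂ + t₂ = A₁ x₁ + t₁ + v := hy
    rw [hfar] at this
    linear_combination (norm := module) (-1 : ℝ) • this
  have hm : A₁.symm (A₁ x₂' - A₁ x₁) ∈ fccStacking 1 (Real.sqrt (2 / 3)) := by
    rw [map_sub, LinearIsometryEquiv.symm_apply_apply, LinearIsometryEquiv.symm_apply_apply]
    exact fcc_sub_site_mem hx₂' hx₁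
  have h3v : A₁.symm ((3 : ℝ) • v) ∈ fccStacking 1 (Real.sqrt (2 / 3)) := by
    have e : (3 : ℝ) • v = (3 : ℝ) • (t₂ - t₁) + ((3 : ℤ) : ℝ) • (A₁ x₂' - A₁ x₁) -
        ((2 * c : ℤ) : ℝ) • ((3 : ℝ) • (Real.sqrt (2 / 3) • n₁)) := by
      rw [hv_eq]; push_cast; module
    rw [e]
    exact symm_mem_fcc_sub A₁ (symm_mem_fcc_add A₁ h3 (symm_mem_fcc_zsmul A₁ 3 hm)) (symm_mem_fcc_zsmul A₁ _ h3n)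
  obtain ⟨a, b, hab⟩ := reachGroup_chainFrames_torsion z A₁ hu₁ hn₁ hmenu₁ hun hv h3v
  refine hnot (a + 2 * c) b ?_
  have e : t₂ - t₁ - ((a + 2 * c : ℤ) : ℝ) • (Real.sqrt (2 / 3) • n₁) -
      (b : ℝ) • (Real.sqrt (2 / 3) • ((2 * Real.sqrt (2 / 3)) • A₁ u₁ - n₁)) =
      (v - (a : ℝ) • (Real.sqrt (2 / 3) • n₁) - (b : ℝ) • (Real.sqrt (2 / 3) • ((2 * Real.sqrt (2 / 3)) • A₁ u₁ - n₁))) -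
      (A₁ x₂' - A₁ x₁) := by
    rw [hv_eq]; push_cast; module
  rw [e]
  exact symm_mem_fcc_sub A₁ hab hm

open scoped Classical in
/-- **`TwoSlabLedgerAt (½κ₁)` for such twin pairs** (`u₁` steep), ARBITRARY fillings, modulo `ExactOnly`(C12-55) and
`StarPairFar`. -/
theorem twoSlabLedgerAt_oneSided_of_level_third_twin
    {s₀ : EuclideanSpace ℝ (Fin 3)} (hs₀ : s₀ ∈ fccSlots)
    (hcert : ExactOnly 0 (fccSlots.filter fun w => 0 < ⟪w, s₀⟫_ℝ)) (hSP : StarPairFar)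
    (A₁ : EuclideanSpace ℝ (Fin 3) ≃ₗᵢ[ℝ] EuclideanSpace ℝ (Fin 3)) (t₁ : EuclideanSpace ℝ (Fin 3))
    (A₂ : EuclideanSpace ℝ (Fin 3) ≃ₗᵢ[ℝ] EuclideanSpace ℝ (Fin 3)) (t₂ : EuclideanSpace ℝ (Fin 3))
    {u₁ n₁ : EuclideanSpace ℝ (Fin 3)} (hu₁ : u₁ ∈ fccSlots)
    (hsteep₁ : Real.sqrt 2 / 2 ≤ ⟪A₁ u₁, EuclideanSpace.single (2 : Fin 3) (1 : ℝ)⟫_ℝ) (hn₁ : ‖n₁‖ = 1)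
    (hmenu₁ : ∀ w ∈ fccSlots, ⟪A₁ w, n₁⟫_ℝ = 0 ∨ ⟪A₁ w, n₁⟫_ℝ = Real.sqrt (2 / 3) ∨ ⟪A₁ w, n₁⟫_ℝ = -Real.sqrt (2 / 3))
    (hun : ⟪A₁ u₁, n₁⟫_ℝ = Real.sqrt (2 / 3))
    (hΛ : A₂ '' fccStacking 1 (Real.sqrt (2 / 3)) = twinFrame A₁ n₁ '' fccStacking 1 (Real.sqrt (2 / 3)))
    (h3 : A₁.symm ((3 : ℝ) • (t₂ - t₁)) ∈ fccStacking 1 (Real.sqrt (2 / 3)))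
    (hnot : ∀ a b : ℤ, A₁.symm (t₂ - t₁ - (a : ℝ) • (Real.sqrt (2 / 3) • n₁) -
      (b : ℝ) • (Real.sqrt (2 / 3) • ((2 * Real.sqrt (2 / 3)) • A₁ u₁ - n₁))) ∉ fccStacking 1 (Real.sqrt (2 / 3))) :
    TwoSlabLedgerAt (Real.sqrt 2 * |⟪A₁ u₁, EuclideanSpace.single (2 : Fin 3) (1 : ℝ)⟫_ℝ| / 2) A₁ t₁ A₂ t₂ :=
  twoSlabLedgerAt_oneSided_reach hs₀ hcert hSP A₁ t₁ A₂ t₂ hu₁ hsteep₁ _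
    (fun _ hS hW hlast => frame_mem_chainFrames_of_stack hS hW hlast)
    (oneSided_offReach_of_level_third_twin _ A₁ t₁ A₂ t₂ hu₁ hn₁ hmenu₁ hun hΛ h3 hnot)

open scoped Classical in
/-- **Lane F's stub conclusion VERBATIM for displaced twins at level ⅓** (coordinate criterion: offset `A₁(y/3)`, `y ∈ Λ₀`,
zone-axis slot `u*` with `3 ∤ 2⟪y, u*⟫`), ARBITRARY fillings, modulo `ExactOnly`(C12-55) and `StarPairFar`. -/
theorem coaxialTwoSlabAdhesion_of_level_third_twin_coords
    {s₀ : EuclideanSpace ℝ (Fin 3)} (hs₀ : s₀ ∈ fccSlots)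
    (hcert : ExactOnly 0 (fccSlots.filter fun w => 0 < ⟪w, s₀⟫_ℝ)) (hSP : StarPairFar)
    (A₁ : EuclideanSpace ℝ (Fin 3) ≃ₗᵢ[ℝ] EuclideanSpace ℝ (Fin 3)) (t₁ : EuclideanSpace ℝ (Fin 3))
    (A₂ : EuclideanSpace ℝ (Fin 3) ≃ₗᵢ[ℝ] EuclideanSpace ℝ (Fin 3)) (t₂ : EuclideanSpace ℝ (Fin 3))
    (hco : ∃ (L : EuclideanSpace ℝ (Fin 3) ≃ₗᵢ[ℝ] EuclideanSpace ℝ (Fin 3))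
        (s₁ s₂ : EuclideanSpace ℝ (Fin 3)) (σ σ' : ℤ → ℤ), IsHaggSeq σ ∧ IsHaggSeq σ' ∧
        (fun p => A₁ p + t₁) '' fccStacking 1 (Real.sqrt (2 / 3)) ⊆
          (fun p => L p + s₁) '' barlowStacking 1 (Real.sqrt (2 / 3)) σ ∧
        (fun p => A₂ p + t₂) '' fccStacking 1 (Real.sqrt (2 / 3)) ⊆
          (fun p => L p + s₂) '' barlowStacking 1 (Real.sqrt (2 / 3)) σ')
    {u₁ n₁ ustar y : EuclideanSpace ℝ (Fin 3)} (hu₁ : u₁ ∈ fccSlots)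
    (hsteep₁ : Real.sqrt 2 / 2 ≤ ⟪A₁ u₁, EuclideanSpace.single (2 : Fin 3) (1 : ℝ)⟫_ℝ) (hn₁ : ‖n₁‖ = 1)
    (hmenu₁ : ∀ w ∈ fccSlots, ⟪A₁ w, n₁⟫_ℝ = 0 ∨ ⟪A₁ w, n₁⟫_ℝ = Real.sqrt (2 / 3) ∨ ⟪A₁ w, n₁⟫_ℝ = -Real.sqrt (2 / 3))
    (hun : ⟪A₁ u₁, n₁⟫_ℝ = Real.sqrt (2 / 3))
    (hΛ : A₂ '' fccStacking 1 (Real.sqrt (2 / 3)) = twinFrame A₁ n₁ '' fccStacking 1 (Real.sqrt (2 / 3)))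
    (hy : y ∈ fccStacking 1 (Real.sqrt (2 / 3))) (ht : t₂ - t₁ = A₁ ((3 : ℝ)⁻¹ • y))
    (hustar : ustar ∈ fccSlots) (hperp : ⟪ustar, u₁⟫_ℝ = 0) (hzone : ⟪A₁ ustar, n₁⟫_ℝ = 0)
    {m : ℤ} (hm : 2 * ⟪y, ustar⟫_ℝ = m) (h3m : ¬ (3 : ℤ) ∣ m) :
    ∃ (L : EuclideanSpace ℝ (Fin 3) ≃ₗᵢ[ℝ] EuclideanSpace ℝ (Fin 3))
        (s₁ s₂ : EuclideanSpace ℝ (Fin 3)) (σ σ' : ℤ → ℤ), IsHaggSeq σ ∧ IsHaggSeq σ' ∧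
        (fun p => A₁ p + t₁) '' fccStacking 1 (Real.sqrt (2 / 3)) ⊆
          (fun p => L p + s₁) '' barlowStacking 1 (Real.sqrt (2 / 3)) σ ∧
        (fun p => A₂ p + t₂) '' fccStacking 1 (Real.sqrt (2 / 3)) ⊆
          (fun p => L p + s₂) '' barlowStacking 1 (Real.sqrt (2 / 3)) σ' ∧
    ∃ C R₀ : ℝ, 1 ≤ R₀ ∧ ∀ h : ℝ, 0 ≤ h → ∀ ρ : ℝ, R₀ ≤ ρ →
      ∀ X P₁ P₂ : Finset (EuclideanSpace ℝ (Fin 3)),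
      (∀ p ∈ X, ∀ q ∈ X, p ≠ q → 1 ≤ dist p q) → P₁ ⊆ X → P₂ ⊆ X \ P₁ →
      (∀ p ∈ X, -(2 * R₀) ≤ p 2 ∧ p 2 ≤ h + 2 * R₀ ∧ p 0 ^ 2 + p 1 ^ 2 ≤ ρ ^ 2) →
      (∀ p, p ∈ P₁ ↔ (p ∈ (fun q => A₁ q + t₁) '' fccStacking 1 (Real.sqrt (2 / 3)) ∧
        -(2 * R₀) ≤ p 2 ∧ p 2 ≤ -R₀ ∧ p 0 ^ 2 + p 1 ^ 2 ≤ ρ ^ 2)) →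
      (∀ p, p ∈ P₂ ↔ (p ∈ (fun q => A₂ q + t₂) '' fccStacking 1 (Real.sqrt (2 / 3)) ∧
        h + R₀ ≤ p 2 ∧ p 2 ≤ h + 2 * R₀ ∧ p 0 ^ 2 + p 1 ^ 2 ≤ ρ ^ 2)) →
      ((((P₁ ×ˢ (X \ P₁)).filter fun pq => dist pq.1 pq.2 = 1).card : ℕ) : ℝ) +
        ((((P₂ ×ˢ ((X \ P₁) \ P₂)).filter fun pq => dist pq.1 pq.2 = 1).card : ℕ) : ℝ) ≤
        contactDeficiency ((X \ P₁) \ P₂) +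
          (Real.sqrt 2 / 4 * ∑ᶠ w ∈ {w ∈ fccStacking 1 (Real.sqrt (2 / 3)) | ‖w‖ = 1},
              |⟪w, A₁.symm (EuclideanSpace.single (2 : Fin 3) (1 : ℝ))⟫_ℝ| +
            Real.sqrt 2 / 4 * ∑ᶠ w ∈ {w ∈ fccStacking 1 (Real.sqrt (2 / 3)) | ‖w‖ = 1},
              |⟪w, A₂.symm (EuclideanSpace.single (2 : Fin 3) (1 : ℝ))⟫_ℝ| -
            (1 / 2 : ℝ) * Real.sqrt (1 - ⟪L (EuclideanSpace.single (2 : Fin 3) (1 : ℝ)),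
              (EuclideanSpace.single (2 : Fin 3) (1 : ℝ))⟫_ℝ ^ 2)) * Real.pi * ρ ^ 2 +
          C * (1 + h) * ρ := by
  obtain ⟨h3, hnot⟩ := level_third_not_mem_two_cosets A₁ hy ht hustar hperp hzone hm h3m
  have hledger := twoSlabLedgerAt_oneSided_of_level_third_twin hs₀ hcert hSP A₁ t₁ A₂ t₂ hu₁ hsteep₁ hn₁ hmenu₁ hun hΛ h3 hnot
  obtain ⟨L, s₁, s₂, σ, σ', hσ, hσ', hsub₁, hsub₂⟩ := hco
  have hκ₁ := one_le_flux_of_steep (A := A₁) (u := u₁) (le_trans hsteep₁ (le_abs_self _))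
  have hle : (1 / 2 : ℝ) * Real.sqrt (1 - ⟪L (EuclideanSpace.single (2 : Fin 3) (1 : ℝ)),
      (EuclideanSpace.single (2 : Fin 3) (1 : ℝ))⟫_ℝ ^ 2) ≤
      Real.sqrt 2 * |⟪A₁ u₁, EuclideanSpace.single (2 : Fin 3) (1 : ℝ)⟫_ℝ| / 2 := by
    have h1 : Real.sqrt (1 - ⟪L (EuclideanSpace.single (2 : Fin 3) (1 : ℝ)),
        (EuclideanSpace.single (2 : Fin 3) (1 : ℝ))⟫_ℝ ^ 2) ≤ 1 := by
      rw [show (1 : ℝ) = Real.sqrt 1 from Real.sqrt_one.symm]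
      exact Real.sqrt_le_sqrt (by rw [Real.sqrt_one]; nlinarith [sq_nonneg ⟪L (EuclideanSpace.single (2 : Fin 3) (1 : ℝ)),
        (EuclideanSpace.single (2 : Fin 3) (1 : ℝ))⟫_ℝ])
    linarith
  exact ⟨L, s₁, s₂, σ, σ', hσ, hσ', hsub₁, hsub₂, twoSlabLedgerAt_mono hle hledger⟩

end Summit.Ventures.Crystal3D.Theorems

end
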